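import Literature.NumberTheory.Automorphic.UnitaryGroupHyperbolicBorelRefinedFibre
import Literature.NumberTheory.Automorphic.UnitaryGroupBorelSemidirect
import HarnessLib

/-!
# The refined regular hyperbolic class is `N`-regular on the rational Borel
(Rogawski, *Automorphic Representations of Unitary Groups in Three Variables* (1990), §3.6 p. 27, §6.1 pp. 79–80;
Arthur, *A trace formula for reductive groups I*, Duke Math. J. 45 (1978), §8.)

For the Borel-refined characteristic-polynomial class map `cl♭` (★ `UnitaryGroupBorelRefinedClassMap`) and its
regular hyperbolic class `i♯ = (((X − a)(X − b)(X − (c a)⁻¹)) ⊗ 𝔸_E, true)`, `c a · a ≠ 1`, `c b · b = 1` (★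
`UnitaryGroupHyperbolicBorelRefinedFibre`): every rational Borel point `β ∈ B(F)` of the class has diagonal
`(a, b, (c a)⁻¹)` or `((c a)⁻¹, b, a)` (★ `diag_eq_or_of_blockTriangular_of_charpoly_eq_hyperbolic`), whose entries are
pairwise distinct (★ `hyperbolic_roots_pairwise_ne`); read as idèles (★ `diagUnit`), `β₀₀ ≠ β₁₁` and `β₀₀ ≠ β₂₂`.
This is the hypothesis `hreg` («the class is `N`-regular on `B(F)`») under which the cusp remainder
`∫ R_T dμ` of the truncated class kernel `k^T_𝔬` vanishes — FALSE for the central and singular classes, TRUE here.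

Theorems only; no definitions, no instances, no notation.
-/

open MeasureTheory Measure NumberField IsDedekindDomain Set Matrix Polynomial
open scoped NNReal ENNReal Classical MatrixGroups

namespace Literature.NumberTheory.Automorphic

namespace UnitaryGroup

variable {F E : Type} [Field F] [NumberField F] [Field E] [NumberField E] [Algebra F E]
  {c : E ≃ₐ[F] E}

/-! ## §1 `N`-regularity of the refined hyperbolic class on `B(F)` -/

section Regular

/-- **THE RATIONAL BOREL POINTS OF THE REFINED HYPERBOLIC CLASS HAVE `N`-REGULAR DIAGONAL**: if `β ∈ B(F)` and
`cl♭ β = (p♯ ⊗ 𝔸_E, true)` then `β₀₀ ≠ β₁₁` and `β₀₀ ≠ β₂₂` as idèles (★ `diagUnit`) — the diagonal of `β` is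
`(a, b, (c a)⁻¹)` or `((c a)⁻¹, b, a)` (★ `diag_eq_or_of_blockTriangular_of_charpoly_eq_hyperbolic`), pairwise distinct
(★ `hyperbolic_roots_pairwise_ne`), and `E → 𝔸_E` is injective. This is the hypothesis `hreg` («the class is
`N`-regular») under which the cusp remainder `∫ R_T dμ` of the truncated class kernel vanishes.
[cite: Rogawski1990, §3.6 (p. 27); §6.1 (pp. 79–80)] [cite: Arthur1978TraceFormulaI, §8] -/
theorem diagUnit_ne_of_borelRefine_eq_hyperbolic (hc : c * c = 1) {a b : Eˣ} (ha : c (a : E) * (a : E) ≠ 1)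
    (hb : c (b : E) * (b : E) = 1) (β : ↥(arithmeticBorel F E c 3))
    (hβ : (fun γ : (quasiSplit F E c 3).arithmeticSubgroup =>
        (((adelicVal F E c 3 _ (γ : (quasiSplit F E c 3).Adelic) : GL (Fin 3) (AdeleRing (𝓞 E) E)) :
            Matrix (Fin 3) (Fin 3) (AdeleRing (𝓞 E) E)).charpoly,
          decide (∃ δ : (quasiSplit F E c 3).arithmeticSubgroup, δ * γ * δ⁻¹ ∈ arithmeticBorel F E c 3)))
          (β : (quasiSplit F E c 3).arithmeticSubgroup) =
        (((X - C (a : E)) * (X - C (b : E)) * (X - C (c (a : E))⁻¹)).map (algebraMap E (AdeleRing (𝓞 E) E)), true)) :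
    diagUnit ((mem_arithmeticBorel_iff _).1 β.2) 0 ≠ diagUnit ((mem_arithmeticBorel_iff _).1 β.2) 1 ∧
      diagUnit ((mem_arithmeticBorel_iff _).1 β.2) 0 ≠ diagUnit ((mem_arithmeticBorel_iff _).1 β.2) 2 := by
  obtain ⟨hab, haa', hba'⟩ := hyperbolic_roots_pairwise_ne (F := F) hc ha hb
  obtain ⟨β₀, hβ₀⟩ := (β : (quasiSplit F E c 3).arithmeticSubgroup).2
  have hchar := (borelRefine_charpoly_eq_hyperbolic_iff hc b ha _).1 hβ
  -- the adelic matrix of `β` is the image of the rational matrix of `β₀`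
  have hm : ((adelicVal F E c 3 _ ((β : (quasiSplit F E c 3).arithmeticSubgroup) : (quasiSplit F E c 3).Adelic) :
      GL (Fin 3) (AdeleRing (𝓞 E) E)) : Matrix (Fin 3) (Fin 3) (AdeleRing (𝓞 E) E)) =
      ((β₀.val : GL (Fin 3) E) : Matrix (Fin 3) (Fin 3) E).map (algebraMap E (AdeleRing (𝓞 E) E)) := by
    rw [← hβ₀]; rfl
  have hB : (((β₀.1 : GL (Fin 3) E) : Matrix (Fin 3) (Fin 3) E)).BlockTriangular id := by
    refine (toAdelic_mem_borelAdelic_iff β₀).1 ?_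
    rw [hβ₀]
    exact (mem_arithmeticBorel_iff _).1 β.2
  have hp : (((β₀.1 : GL (Fin 3) E) : Matrix (Fin 3) (Fin 3) E)).charpoly =
      (X - C (a : E)) * (X - C (b : E)) * (X - C (c (a : E))⁻¹) := by
    apply Polynomial.map_injective _ (AdeleRing.algebraMap_injective (𝓞 E) E)
    rw [← charpoly_adelicVal_toAdelic, hβ₀]
    exact hchar
  -- the diagonal idèles are the images of the rational diagonal entries
  have hdiag : ∀ k : Fin 3, (diagUnit ((mem_arithmeticBorel_iff _).1 β.2) k : AdeleRing (𝓞 E) E) =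
      algebraMap E (AdeleRing (𝓞 E) E) (((β₀.1 : GL (Fin 3) E) : Matrix (Fin 3) (Fin 3) E) k k) := by
    intro k
    rw [coe_diagUnit, hm, Matrix.map_apply]
  have hne : ∀ {j k : Fin 3}, ((β₀.1 : GL (Fin 3) E) : Matrix (Fin 3) (Fin 3) E) j j ≠
      ((β₀.1 : GL (Fin 3) E) : Matrix (Fin 3) (Fin 3) E) k k →
      diagUnit ((mem_arithmeticBorel_iff _).1 β.2) j ≠ diagUnit ((mem_arithmeticBorel_iff _).1 β.2) k := by
    intro j k hjk h
    apply hjk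
    apply AdeleRing.algebraMap_injective (𝓞 E) E
    rw [← hdiag j, ← hdiag k, h]
  rcases diag_eq_or_of_blockTriangular_of_charpoly_eq_hyperbolic hc ha hb hB hp with ⟨h0, h1, h2⟩ | ⟨h0, h1, h2⟩
  · exact ⟨hne (by rw [h0, h1]; exact hab), hne (by rw [h0, h2]; exact haa')⟩
  · exact ⟨hne (by rw [h0, h1]; exact hba'.symm), hne (by rw [h0, h2]; exact fun h => haa' h.symm)⟩

/-- The same as the hypothesis `hreg` is spelled by its consumer: for EVERY `β ∈ B(F)` of the refined hyperbolic
class, `β₀₀ ≠ β₁₁ ∧ β₀₀ ≠ β₂₂`. [cite: Rogawski1990, §6.1 (pp. 79–80)] [cite: Arthur1978TraceFormulaI, §8] -/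
theorem forall_diagUnit_ne_of_borelRefine_eq_hyperbolic (hc : c * c = 1) {a b : Eˣ} (ha : c (a : E) * (a : E) ≠ 1)
    (hb : c (b : E) * (b : E) = 1) :
    ∀ β : ↥(arithmeticBorel F E c 3),
      (fun γ : (quasiSplit F E c 3).arithmeticSubgroup =>
        (((adelicVal F E c 3 _ (γ : (quasiSplit F E c 3).Adelic) : GL (Fin 3) (AdeleRing (𝓞 E) E)) :
            Matrix (Fin 3) (Fin 3) (AdeleRing (𝓞 E) E)).charpoly,
          decide (∃ δ : (quasiSplit F E c 3).arithmeticSubgroup, δ * γ * δ⁻¹ ∈ arithmeticBorel F E c 3)))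
          (β : (quasiSplit F E c 3).arithmeticSubgroup) =
        (((X - C (a : E)) * (X - C (b : E)) * (X - C (c (a : E))⁻¹)).map (algebraMap E (AdeleRing (𝓞 E) E)), true) →
      diagUnit ((mem_arithmeticBorel_iff _).1 β.2) 0 ≠ diagUnit ((mem_arithmeticBorel_iff _).1 β.2) 1 ∧
        diagUnit ((mem_arithmeticBorel_iff _).1 β.2) 0 ≠ diagUnit ((mem_arithmeticBorel_iff _).1 β.2) 2 :=
  fun β hβ => diagUnit_ne_of_borelRefine_eq_hyperbolic hc ha hb β hβ

end Regular

end UnitaryGroup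

end Literature.NumberTheory.Automorphic
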